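import Summits.QuantumFields.YangMills.Theorems.FluctuationComparisonRegPrIntLS2BetaKPLIncrement
import Literature.Probability.LatticeModels.PolymerPressure

/-!
# KPL-B · the convergent one-polymer expansion of the truncated functional and the smallness of the increment ratio

Cell `ym3-torus` (rung R3 = continuum SU(2) Yang–Mills on `T³`; NOT `d = 4`, NOT infinite volume, NOT a mass gap, NOT the
Clay problem), crux `stmt-QuantumFields-20520`, LINE g19-1 `Cruxes/FluctuationComparisonRegPrIntL/Lines/largefield_gas.lean` v2,
stub **KPL**.  Second support file of the alternating-sign majorant (sibling `…S2BetaKPLSignMajorant.lean`), on top of KPL-A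
`…S2BetaKPLIncrement.lean`:

* §0 small tools (domination of KP volumes, reality of `Φ^T` for real activities; `Φ^T(∅) = 0` is the tree's `PolymerPressure.truncatedWeight_empty`);
* §1 **`hasSum_expansion`**: on a KP volume `L ⊇ C' ∪ x`, if every increment ratio `t v(x) Z(Bˣ; tv)/Z(B; tv)` (`B ⊆ C'`,
  `t ∈ [0,1]`) has norm `< 1`, then
  `Φ^T(v; C' ∪ x) = Σ_{m ≥ 1} (−1)^{m+1} (v(x)^m/m) Σ_{𝒟 ⊆ {D ⊆ C' : D ι x}, ⋃𝒟 = C'} Π_{D ∈ 𝒟} (e^{−m Φ^T(D; v)} − 1)` as a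
  convergent series — `Φ^T(C' ∪ x) = Σ_B (−1)^{|C'∖B|}(log Z(B ∪ x) − log Z(B))`, each increment `= Log(1 + u_B)` (KPL-A),
  `Log(1 + u) = Σ (−1)^{m+1} u^m/m` (Mathlib `Complex.hasSum_taylorSeries_log`), `u_B^m = v(x)^m exp(−Σ_{D ⊆ B, D ι x} m Φ^T(D))`
  ([KP86] (5)) and the unmarked Möbius extraction of KPL-A; every `D` is a PROPER sub-family of `C' ∪ x`;
* §2 **`smallness_of_hyp`**: if `‖Φ^T(v'; D)‖ ≤ −Re Φ^T(−r; D)` for all `D ⊆ B` and `‖v'‖ ≤ r` (the induction hypothesis of the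
  majorant), then `‖v(x) Z(Bˣ; v)/Z(B; v)‖ ≤ r(x) Z(Bˣ; −r)/Z(B; −r) < 1`, the last by POSITIVITY of
  `Z(B ∪ x; −r) = Z(B; −r) − r(x) Z(Bˣ; −r)` on the real Kotecký–Preiss segment.

Everything is PROVED (0 sorry, no new definitions, no named facts).  HONEST: abstract cluster-expansion lemmas; nothing here is a
claim about Bałaban's renormalisation group, `FluctuationComparisonRegPrIntL`, `LargeFieldPolymerRepCan`, or YM₃ on `T³`.

References: A. D. Scott, A. D. Sokal, J. Stat. Phys. 118 (2005) 1151–1261 (arXiv:cond-mat/0309352) Prop. 2.8 [ScottSokal2005];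
R. Kotecký, D. Preiss, Comm. Math. Phys. 103 (1986) 491–498, Theorem p. 492, (3), (5) [KoteckyPreiss1986].
-/

noncomputable section

open Finset Filter Topology Set
open scoped BigOperators
open Literature.Probability.LatticeModels
open Summit.QuantumFields.YangMills.Theorems.FluctuationComparisonRegPrIntLS2BetaKPLIncrement

namespace Summit.QuantumFields.YangMills.Theorems.FluctuationComparisonRegPrIntLS2BetaKPLExpansion

variable {P : Type*} [DecidableEq P] {inc : P → P → Prop} [DecidableRel inc]

/-! ## §0 Small tools -/

omit [DecidableEq P] in
/-- A complex activity dominated in norm by a KP-small real activity is KP-small (same size function). [cite: KoteckyPreiss1986, (1)] -/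
theorem isKPVolume_of_norm_le {r : P → ℝ} {a : P → ℝ} {L : Finset P}
    (hKP : IsKPVolume inc (fun γ => ((r γ : ℝ) : ℂ)) a L) (hr : ∀ γ, 0 ≤ r γ) {v : P → ℂ}
    (hv : ∀ γ ∈ L, ‖v γ‖ ≤ r γ) : IsKPVolume inc v a L := fun γ hγ => by
  refine le_trans (Finset.sum_le_sum fun γ' hγ' => ?_) (hKP γ hγ)
  unfold kpTerm
  refine mul_le_mul_of_nonneg_right ?_ (Real.exp_nonneg _)
  rw [Complex.norm_real, Real.norm_eq_abs, abs_of_nonneg (hr γ')]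
  exact hv γ' (Finset.mem_filter.1 hγ').1

omit [DecidableEq P] in
/-- The negative real corner `−r` is dominated by `r`. [folklore] -/
theorem norm_neg_ofReal_le {r : P → ℝ} (hr : ∀ γ, 0 ≤ r γ) (L : Finset P) :
    ∀ γ ∈ L, ‖(((-r γ : ℝ)) : ℂ)‖ ≤ r γ := fun γ _ => by
  rw [Complex.norm_real, Real.norm_eq_abs, abs_neg, abs_of_nonneg (hr γ)]

omit [DecidableEq P] in
/-- Scaling a nonnegative radius by `t ∈ [0,1]` keeps it nonnegative and KP-small. [cite: KoteckyPreiss1986, (1)] -/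
theorem isKPVolume_smul_radius {r : P → ℝ} {a : P → ℝ} {L : Finset P}
    (hKP : IsKPVolume inc (fun γ => ((r γ : ℝ) : ℂ)) a L) (hr : ∀ γ, 0 ≤ r γ) {t : ℝ} (ht : t ∈ Set.Icc (0 : ℝ) 1) :
    IsKPVolume inc (fun γ => (((t * r γ : ℝ)) : ℂ)) a L := by
  refine isKPVolume_of_norm_le hKP hr fun γ _ => ?_
  rw [Complex.norm_real, Real.norm_eq_abs, abs_of_nonneg (mul_nonneg ht.1 (hr γ))]
  exact mul_le_of_le_one_left (hr γ) ht.2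

/-- For real activities the truncated functional is real. [cite: KoteckyPreiss1986, (3)] -/
theorem im_truncatedWeight_ofReal (f : P → ℝ) (C : Finset P) :
    (truncatedWeight inc (fun γ => ((f γ : ℝ) : ℂ)) C).im = 0 := by
  unfold truncatedWeight
  rw [Complex.im_sum]
  refine Finset.sum_eq_zero fun B _ => ?_
  rw [Complex.mul_im, im_polymerLogZ_ofReal, mul_zero, zero_add]
  have : ((-1 : ℂ) ^ (C \ B).card).im = 0 := by
    have h : (-1 : ℂ) = ((-1 : ℝ) : ℂ) := by push_cast; rfl
    rw [h, ← Complex.ofReal_pow, Complex.ofReal_im]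
  rw [this, zero_mul]

omit [DecidableEq P] in
/-- Membership bookkeeping: a member of a family of `T`-subsets of `C'` is a subset of `C'`. [folklore] -/
theorem subset_of_mem_of_mem_powerset_filter {C' : Finset P} {T : Finset P → Prop} [DecidablePred T]
    {𝒟 : Finset (Finset P)} (h𝒟 : 𝒟 ∈ (C'.powerset.filter T).powerset) {D : Finset P} (hD : D ∈ 𝒟) : D ⊆ C' :=
  Finset.mem_powerset.1 (Finset.mem_filter.1 (Finset.mem_powerset.1 h𝒟 hD)).1

/-! ## §1 The convergent expansion of `Φ^T(v; C' ∪ x)` through the proper sub-families -/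

section Expansion

variable [Std.Refl inc] [Std.Symm inc]

/-- **THE EXPANSION.** On a KP volume `L ⊇ C' ∪ x` (`x ∉ C'`), if along the ray `t·v` every one-polymer increment ratio
`t v(x) Z(Bˣ; tv)/Z(B; tv)`, `B ⊆ C'`, has norm `< 1`, then
`Φ^T(v; C' ∪ x) = Σ_{m ≥ 1} (−1)^{m+1} (v(x)^m/m) · Σ_{𝒟 ⊆ {D ⊆ C' : D ι x}, ⋃𝒟 = C'} Π_{D ∈ 𝒟} (e^{−m Φ^T(D; v)} − 1)`
as a convergent series (the `m = 0` term vanishes by `z^0/0 = 0`). [cite: ScottSokal2005, Prop. 2.8 (proof); KoteckyPreiss1986, (3) and (5)] -/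
theorem hasSum_expansion {v : P → ℂ} {a : P → ℝ} {L : Finset P} (hKPv : IsKPVolume inc v a L)
    {x : P} {C' : Finset P} (hxC : insert x C' ⊆ L) (hx : x ∉ C')
    (hsmall : ∀ B ⊆ C', ∀ t ∈ Set.Icc (0 : ℝ) 1,
      ‖(t : ℂ) * v x * (polymerPartitionFunction inc (fun γ => (t : ℂ) * v γ) (B.filter fun γ' => ¬ inc x γ') /
        polymerPartitionFunction inc (fun γ => (t : ℂ) * v γ) B)‖ < 1) :
    HasSum (fun m : ℕ => (-1 : ℂ) ^ (m + 1) * v x ^ m / (m : ℂ) *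
        ∑ 𝒟 ∈ (C'.powerset.filter fun D => KPTouches inc D x).powerset,
          (if 𝒟.biUnion id = C' then ∏ D ∈ 𝒟, (Complex.exp (-((m : ℂ) * truncatedWeight inc v D)) - 1) else 0))
      (truncatedWeight inc v (insert x C')) := by
  have hC'L : C' ⊆ L := (Finset.subset_insert x C').trans hxC
  have hxL : x ∈ L := hxC (Finset.mem_insert_self x C')
  -- the increment ratio `u_B` and its cluster form
  set u : Finset P → ℂ := fun B => v x * (polymerPartitionFunction inc v (B.filter fun γ' => ¬ inc x γ') /
      polymerPartitionFunction inc v B) with hu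
  have hratio : ∀ B ⊆ C', u B = v x *
      Complex.exp (-∑ D ∈ B.powerset with KPTouches inc D x, truncatedWeight inc v D) := by
    intro B hB
    simp only [hu]
    rw [filter_div_eq_cexp_neg_touchSum (hKPv.mono (hB.trans hC'L)) x]
  have hsmall1 : ∀ B ⊆ C', ‖u B‖ < 1 := by
    intro B hB
    have h := hsmall B hB 1 ⟨zero_le_one, le_rfl⟩
    have hv1 : (fun γ => ((1 : ℝ) : ℂ) * v γ) = v := funext fun γ => by simp
    rw [hv1, Complex.ofReal_one, one_mul] at h
    exact h
  -- the one-polymer increments (KPL-A)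
  have hincr : ∀ B ⊆ C', polymerLogZ inc v (insert x B) - polymerLogZ inc v B = Complex.log (1 + u B) := by
    intro B hB
    have hxB : x ∉ B := fun h => hx (hB h)
    have hiL : insert x B ⊆ L := Finset.insert_subset hxL (hB.trans hC'L)
    rw [polymerLogZ_insert_eq_add_clog hKPv hiL hxB (hsmall B hB)]
    ring
  -- per-`B` logarithmic series, signed and summed over `B ⊆ C'`
  have hserB : ∀ B ∈ C'.powerset, HasSum (fun m : ℕ => (-1 : ℂ) ^ (C' \ B).card *
      ((-1 : ℂ) ^ (m + 1) * u B ^ m / (m : ℂ)))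
      ((-1 : ℂ) ^ (C' \ B).card * (polymerLogZ inc v (insert x B) - polymerLogZ inc v B)) := by
    intro B hB
    have hB' := Finset.mem_powerset.1 hB
    rw [hincr B hB']
    exact (Complex.hasSum_taylorSeries_log (hsmall1 B hB')).mul_left _
  have hsum := hasSum_sum hserB
  rw [truncatedWeight_insert_eq_sum v hx]
  convert hsum using 1
  funext m
  -- the `m`-th coefficient: `u_B^m = v(x)^m exp(−Σ_D m Φ^T(D))`, then unmarked Möbius extraction
  have hpow : ∀ B ⊆ C', u B ^ m = v x ^ m *
      Complex.exp (-∑ D ∈ B.powerset with KPTouches inc D x, (m : ℂ) * truncatedWeight inc v D) := by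
    intro B hB
    rw [hratio B hB, mul_pow, ← Complex.exp_nat_mul, mul_neg, Finset.mul_sum]
  symm
  calc ∑ B ∈ C'.powerset, (-1 : ℂ) ^ (C' \ B).card * ((-1 : ℂ) ^ (m + 1) * u B ^ m / (m : ℂ))
      = ∑ B ∈ C'.powerset, (-1 : ℂ) ^ (C' \ B).card * ((-1 : ℂ) ^ (m + 1) * (v x ^ m *
          Complex.exp (-∑ D ∈ B.powerset with KPTouches inc D x, (m : ℂ) * truncatedWeight inc v D)) / (m : ℂ)) :=
        Finset.sum_congr rfl fun B hB => by rw [hpow B (Finset.mem_powerset.1 hB)]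
    _ = (-1 : ℂ) ^ (m + 1) * v x ^ m / (m : ℂ) * ∑ B ∈ C'.powerset, (-1 : ℂ) ^ (C' \ B).card *
          Complex.exp (-∑ D ∈ B.powerset with KPTouches inc D x, (m : ℂ) * truncatedWeight inc v D) := by
        rw [Finset.mul_sum]
        exact Finset.sum_congr rfl fun B _ => by ring
    _ = _ := by rw [moebius_cexp_neg_sum_eq]

end Expansion

/-! ## §2 Smallness of the increment ratio from the induction hypothesis and positivity on the real segment -/

section Smallness

variable [Std.Refl inc] [Std.Symm inc]

/-- **Smallness of the one-polymer increment ratio.**  If `r ≥ 0` is KP-small on `L ∋ x`, `B ⊆ L ∖ x`, and the majorant property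
`‖Φ^T(v; D)‖ ≤ −Re Φ^T(−r; D)` holds for all `D ⊆ B` and all `‖v‖ ≤ r` (the induction hypothesis), then for every `‖v‖ ≤ r`:
`‖v(x) Z(Bˣ; v)/Z(B; v)‖ ≤ r(x) Z(Bˣ; −r)/Z(B; −r) < 1`, the last because `Z(B; −r) − r(x) Z(Bˣ; −r) = Z(B ∪ x; −r) > 0` on the real
Kotecký–Preiss segment. [cite: KoteckyPreiss1986, Theorem p. 492 and (5); ScottSokal2005, Prop. 2.8] -/
theorem smallness_of_hyp {r : P → ℝ} (hr : ∀ γ, 0 ≤ r γ) {a : P → ℝ} {L : Finset P}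
    (hKP : IsKPVolume inc (fun γ => ((r γ : ℝ) : ℂ)) a L) {x : P} (hxL : x ∈ L) {B : Finset P} (hBL : B ⊆ L)
    (hxB : x ∉ B)
    (hIH : ∀ D ⊆ B, ∀ v : P → ℂ, (∀ γ ∈ L, ‖v γ‖ ≤ r γ) →
      ‖truncatedWeight inc v D‖ ≤ -(truncatedWeight inc (fun γ => ((-r γ : ℝ) : ℂ)) D).re)
    {v : P → ℂ} (hv : ∀ γ ∈ L, ‖v γ‖ ≤ r γ) :
    ‖v x * (polymerPartitionFunction inc v (B.filter fun γ' => ¬ inc x γ') / polymerPartitionFunction inc v B)‖ < 1 := by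
  set ρ : P → ℂ := fun γ => ((-r γ : ℝ) : ℂ) with hρ
  set Bx : Finset P := B.filter fun γ' => ¬ inc x γ' with hBx
  have hKPv : IsKPVolume inc v a L := isKPVolume_of_norm_le hKP hr hv
  have hKPρ : IsKPVolume inc ρ a L := isKPVolume_of_norm_le hKP hr (norm_neg_ofReal_le hr L)
  have hBxL : Bx ⊆ L := (Finset.filter_subset _ B).trans hBL
  -- ratios through clusters ([KP86] (5))
  set Sv : ℂ := ∑ D ∈ B.powerset with KPTouches inc D x, truncatedWeight inc v D with hSv
  set Sρ : ℂ := ∑ D ∈ B.powerset with KPTouches inc D x, truncatedWeight inc ρ D with hSρ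
  have hv_ratio : polymerPartitionFunction inc v Bx / polymerPartitionFunction inc v B = Complex.exp (-Sv) :=
    filter_div_eq_cexp_neg_touchSum (hKPv.mono hBL) x
  have hρ_ratio : polymerPartitionFunction inc ρ Bx / polymerPartitionFunction inc ρ B = Complex.exp (-Sρ) :=
    filter_div_eq_cexp_neg_touchSum (hKPρ.mono hBL) x
  -- reality of the `−r` side
  have hSρ_im : Sρ.im = 0 := by
    simp only [hSρ]
    rw [Complex.im_sum]
    exact Finset.sum_eq_zero fun D _ => im_truncatedWeight_ofReal (fun γ => -r γ) D
  have hSρ_eq : -Sρ = (((-Sρ.re : ℝ)) : ℂ) := by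
    have := (Complex.conj_eq_iff_re.1 (Complex.conj_eq_iff_im.2 hSρ_im)).symm
    rw [this]; push_cast; simp
  -- domination of the `v` side by the `−r` side
  have hdom : ‖Complex.exp (-Sv)‖ ≤ Real.exp (-Sρ.re) := by
    rw [Complex.norm_exp]
    apply Real.exp_le_exp.2
    calc (-Sv).re ≤ ‖-Sv‖ := Complex.re_le_norm _
      _ = ‖Sv‖ := norm_neg _
      _ ≤ ∑ D ∈ B.powerset with KPTouches inc D x, ‖truncatedWeight inc v D‖ := norm_sum_le _ _
      _ ≤ ∑ D ∈ B.powerset with KPTouches inc D x, -(truncatedWeight inc ρ D).re :=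
          Finset.sum_le_sum fun D hD => hIH D (Finset.mem_powerset.1 (Finset.mem_filter.1 hD).1) v hv
      _ = -Sρ.re := by simp only [hSρ]; rw [Complex.re_sum, Finset.sum_neg_distrib]
  -- positivity on the real KP segment
  have hposB : 0 < (polymerPartitionFunction inc ρ B).re :=
    re_polymerPartitionFunction_pos_of_kp (f := fun γ => -r γ) hKPρ hBL
  have hposI : 0 < (polymerPartitionFunction inc ρ (insert x B)).re :=
    re_polymerPartitionFunction_pos_of_kp (f := fun γ => -r γ) hKPρ (Finset.insert_subset hxL hBL)
  have hZB : polymerPartitionFunction inc ρ B = (((polymerPartitionFunction inc ρ B).re : ℝ) : ℂ) :=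
    polymerPartitionFunction_ofReal_eq_re (fun γ => -r γ) B
  have hZBx : polymerPartitionFunction inc ρ Bx = (((polymerPartitionFunction inc ρ Bx).re : ℝ) : ℂ) :=
    polymerPartitionFunction_ofReal_eq_re (fun γ => -r γ) Bx
  -- `exp(−Re Sρ) = Z(Bˣ; −r)/Z(B; −r)` (real numbers)
  have hexp_re : Real.exp (-Sρ.re) =
      (polymerPartitionFunction inc ρ Bx).re / (polymerPartitionFunction inc ρ B).re := by
    have h := hρ_ratio
    rw [hZB, hZBx, ← Complex.ofReal_div, hSρ_eq, ← Complex.ofReal_exp] at h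
    exact (Complex.ofReal_injective h).symm
  -- `Z(B; −r) − r(x) Z(Bˣ; −r) = Z(B ∪ x; −r) > 0`
  have hins : (polymerPartitionFunction inc ρ (insert x B)).re =
      (polymerPartitionFunction inc ρ B).re + (-r x) * (polymerPartitionFunction inc ρ Bx).re := by
    rw [polymerPartitionFunction_insert inc_symm_of_symm ρ hxB, Complex.add_re]
    simp only [hρ, hBx, Complex.re_ofReal_mul]
  have hlt : r x * Real.exp (-Sρ.re) < 1 := by
    rw [hexp_re, ← mul_div_assoc, div_lt_one hposB]
    have : 0 < (polymerPartitionFunction inc ρ B).re - r x * (polymerPartitionFunction inc ρ Bx).re := by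
      rw [hins] at hposI; linarith
    linarith
  -- conclusion
  calc ‖v x * (polymerPartitionFunction inc v Bx / polymerPartitionFunction inc v B)‖
      = ‖v x‖ * ‖Complex.exp (-Sv)‖ := by rw [norm_mul, hv_ratio]
    _ ≤ r x * Real.exp (-Sρ.re) :=
        mul_le_mul (hv x hxL) hdom (norm_nonneg _) (hr x)
    _ < 1 := hlt

end Smallness

end Summit.QuantumFields.YangMills.Theorems.FluctuationComparisonRegPrIntLS2BetaKPLExpansion

end
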